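import Summits.QuantumFields.YangMills.Theorems.BalabanUVNodesN18HLayerW1NumeralsStrict
import Literature.MathematicalPhysics.QuantumFieldTheory.Balaban1983to89.Node00.HistoryTermIndexedGenerator

/-!
# BalabanUVNodes ∕ N18 — THE H-LAYER DATUM AT node00-def-W1's TERM-INDEXED GENERATOR OF RECORD: at `G := GenTower.ofTerms L T` the per-generator schema
# (GEN-T) IS [II] (2.14) analyticity + (2.26) PER PRINTED TERM `(𝐃, P) ∈ terms L M Z` — the domination clause is W1's `norm_H_ofTerms_le` — so files 17 ∕ 18's
# conclusions (W1's `RecAdmissible`, the (2.38) pair at every step, (1.18), L05 ∕ L06 at the admissible pairing) follow from TWO PER-TERM SCHEMAS, and at the tree's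
# witness numerals from those two alone (Track A, DAG node N18 = NE5 `T4OutputRate.NE5 EA EB W κ θ C₅` :211; cluster K4 «SpineRates»; file 23 of seat
# pub-ymgap-dag-n18-c, row s1, generation 5)

Cell `pub-ymgap`, HUMAN RULING D-0062 (Track A), R134 ACCELERATION seat `pub-ymgap-dag-n18-c` (strategy s1), generation 5.  THEOREMS ONLY (no `def` ∕ `instance` ∕
`sorry`); imports file 19 `…N18HLayerW1NumeralsStrict` (hence files 16 ∕ 18 ∕ 17 ∕ 12) and node00-def-W1 g6's `Node00/HistoryTermIndexedGenerator` (p494929: `W1.TermFun`,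
`StepGen.ofTerms`, `GenTower.ofTerms`, `norm_H_ofTerms_le`, `forall_mem_idx_ofTerms_iff`) BY NAME; restates nothing.  K3‴ helper.

WHY.  g4's HANDOFF trigger (t1) «per-generator data in (GEN)∕(GEN-T) shape» FIRED in its weak form: W1 g6 typed THE ONE-STEP GENERATOR IN PRINT'S TERM INDEX —
`StepGen.ofTerms L T`, indices at `Z` = `{Z} × terms L M Z`, generic term = a TERM FUNCTIONAL `T Z (𝐃,P) g_k old φ` (DATA: the value of the (2.14) term as a function of the
last coupling, the older terms and the configuration), activity `H(Z) = Σ_{(𝐃,P) ∈ terms L M Z} T Z (𝐃,P) …` (`ofTerms_H`).  At this generator the three clauses of file 18's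
(GEN-T) collapse to TWO per-term schemas: (T-an) «older terms obeying (1.18)`(E₀,r₁)` and analytic on the tables ⟹ every term `φ ↦ T k Z (𝐃,P) g_k old φ` is analytic
at the points of `sp (k+1) Z`» ((2.14) p. 15: «analytic functions of (U, J) on the space …») and (T-226) «… ⟹ |T k Z (𝐃,P) g_k old φ| ≤ weight(𝐃,P)·e^{a₅|Z|} on
`sp (k+1) Z`» ((2.26) p. 17) — the domination clause `‖H‖ ≤ Σ‖T‖` is W1's `norm_H_ofTerms_le` (triangle inequality), not a hypothesis.  THIS FILE types that collapse
and re-reads files 17 ∕ 18 ∕ 19 at `GenTower.ofTerms L T`: what NODE A ∕ N10 owes for the GENERATOR OF RECORD is exactly (T-an) + (T-226) for its term functional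
`TF` (node00-def-B13's `ResidB13K.T₃` read as a `W1.TermFun` — W1 g6's successor trigger (i), not typed here).

WHAT (theorems only; `F.P K`, bond-cube side `M`, block factor `L`).
* §1 ★ `stepGenT_ofTerms_of_termwise` ((T-an) + (T-226) ⟹ file 18's (GEN-T) at `GenTower.ofTerms L T` with term maps `Tm k t old Z (𝐃,P) φ := T k Z (𝐃,P) t old φ`),
  ★ `stepGen_ofTerms_of_termwise` (⟹ (GEN) with `A = C₃ε₁`, `R = (1−8δ)·½L·κ`).
* §2 at `GenTower.ofTerms L T` from (T-an) + (T-226) + ONE numerics bundle + the restriction property + the clauses: `recAdmissible_ofTerms_of_termwise` (W1's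
  `RecAdmissible`), `hLayer_toClusterTower_ofTerms_of_termwise` (the (2.38) pair at every step on the boxes `]0,γ]^{k+1}`), `termBound118_toClusterTower_ofTerms_of_termwise`
  ((1.18)), `decayBound_EA_ofRecordAdm_ofTerms_of_termwise` ∕ `decayBound_EB_ofRecordAdm_ofTerms_of_termwise` (L05 ∕ L06 at the admissible pairing of record).
* §3 AT THE TREE's WITNESS NUMERALS (file 19 §2: `consts`, `L = 8`, rate `aw + 40M`, `a₅ = ½`, `(E₀, r₁) := (consts.E₀, consts.κ)`): ★★ `recAdmissible_ofTerms_of_termwise_consts`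
  and ★★ `hLayer_toClusterTower_ofTerms_of_termwise_consts` — hypotheses = (T-an) + (T-226) + the tables' restriction property ONLY (every numeric clause discharged).
* §4 honesty: `termwise_ofTerms_zero` — at the ZERO term functional both schemas hold outright (W1's `recTerm_ofTerms_zero` species: the junction pins the index set and
  the shape of the dependence, nothing analytic).

HONEST FRAMING.  Count-neutral kernel bookkeeping (re-indexing through W1's faces + files 17 ∕ 18 ∕ 19 by name); the term functional is DATA and (T-an) ∕ (T-226) for the
term functional OF RECORD are NODE A's ∕ N10's Lemmas 1–3 content, DISPLAYED; NOT a discharge of N18 (typed 28∕28 · discharged 5∕27 UNCHANGED); NE5 NOT IN PRINT ∕ NOT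
PROVED; finite four-torus at fixed ε — NOT infinite volume ∕ OS ∕ mass gap ∕ Clay.  0 `sorry`, 0 `def`, standard axioms.

References (TYPES only): [II] = [Balaban1988RG2Cluster] (2.9)–(2.11) p. 14, (2.14) p. 15, (2.26) p. 17, Lemma 3 (2.38) p. 20, (2.41) p. 21, p. 22; [I] = [Balaban1987RG1]
§1 p. 263, (2.12)–(2.13) p. 268, Thm 1 p. 259.
-/

noncomputable section

namespace Summit.QuantumFields.YangMills.BalabanUVNodes.N18HLayerW1TermIndexed

open Set Metric
open scoped BigOperators Matrix.Norms.L2Operator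
open Literature.MathematicalPhysics.QuantumFieldTheory.Balaban1983to89
open Literature.MathematicalPhysics.QuantumFieldTheory.Balaban1983to89.T4Continuum (T4Family)
open Literature.MathematicalPhysics.QuantumFieldTheory.Balaban1983to89.T4OutputRate
open Literature.MathematicalPhysics.QuantumFieldTheory.Balaban1983to89.TreeLengthTorus (TDom)
open Literature.MathematicalPhysics.QuantumFieldTheory.Balaban1983to89.B12TreeDecay (K₀)
open Literature.MathematicalPhysics.QuantumFieldTheory.Balaban1983to89.B13Lemma3TorusData (TBond)
open Literature.MathematicalPhysics.QuantumFieldTheory.Balaban1983to89.B13Lemma3TorusTerms (terms weight)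
open Literature.MathematicalPhysics.QuantumFieldTheory.Balaban1983to89.B13Lemma3TorusSocket (Lemma3Numerics)
open Literature.MathematicalPhysics.QuantumFieldTheory.Balaban1983to89.B13Lemma3WindowNonvacuity (aw)
open Literature.MathematicalPhysics.QuantumFieldTheory.Balaban1983to89.B13Lemma3TorusNonvacuity (consts)
open Literature.MathematicalPhysics.QuantumFieldTheory.Balaban1983to89.Node00
open Literature.MathematicalPhysics.QuantumFieldTheory.Balaban1983to89.Node00.Sect2 (domSys domCount CPair ofBackgroundC)
open Literature.MathematicalPhysics.QuantumFieldTheory.Balaban1983to89.Node00.W1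
open Summit.QuantumFields.YangMills.BalabanUVNodes.N18HLayerW1RecursionTerms (stepGen_of_stepGenT)
open Summit.QuantumFields.YangMills.BalabanUVNodes.N18HLayerW1Recursion (recAdmissible_of_stepGen hLayer_toClusterTower_of_stepGen
  termBound118_toClusterTower_of_stepGen decayBound_EA_ofRecordAdm_toClusterTower_of_stepGen decayBound_EB_ofRecordAdm_toClusterTower_of_stepGen)
open Summit.QuantumFields.YangMills.BalabanUVNodes.N18HLayerW1NumeralsStrict (chainNumerals_consts_anyM)

/-! ## §1 (T-an) + (T-226) at the term-indexed generator ⟹ (GEN-T) ⟹ (GEN) -/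

section Collapse

variable (F : T4Family) (K : ℕ) {𝔸 : Type} [NormedRing 𝔸] [NormedAlgebra ℂ 𝔸] {M : ℕ} [NeZero M] (L : ℕ) [NeZero L]

open Classical in
/-- **★ (T-an) + (T-226) ⟹ (GEN-T) AT THE TERM-INDEXED GENERATOR.**  For a term-functional family `T` and `G := GenTower.ofTerms L T`: the two PER-TERM schemas — for every
step `k`, every last coupling `t ∈ D`, every older-term table obeying (1.18)`(E₀,r₁)` on the tables `sp j` (`j ≤ k`) and analytic there, (T-an) every term
`φ ↦ T k Z (𝐃,P) t old φ`, `(𝐃,P) ∈ terms L M Z`, is analytic at the points of `sp (k+1) Z` and (T-226) `‖T k Z (𝐃,P) t old φ‖ ≤ weight L M c Z a (𝐃,P)·e^{a₅|Z|}` on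
`sp (k+1) Z` — give file 18's (GEN-T) for `G` with term maps the functional itself: clause (i) by W1's `forall_mem_idx_ofTerms_iff`, the domination clause (ii) by W1's
`norm_H_ofTerms_le`, clause (iii) verbatim. [cite: Balaban1988RG2Cluster, (2.9)-(2.11) p.14, (2.14) p.15 and (2.26) p.17] -/
theorem stepGenT_ofTerms_of_termwise (T : GenTermFun (F.P K) 𝔸 M L) (D : Set ℂ)
    (sp : (j : ℕ) → (domSys (F.P K) M j).Dom → Set (CPair (F.P K) 𝔸)) {E₀ r₁ : ℝ} (c : B13.Consts) {a a₅ : ℝ}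
    (hTan : ∀ k : ℕ, ∀ t ∈ D, ∀ old : OlderTerms (F.P K) 𝔸 M k,
      (∀ (j : Fin (k + 1)) (Y : (domSys (F.P K) M j).Dom), ∀ ψ ∈ sp j Y,
          ‖old j Y ψ‖ ≤ E₀ * Real.exp (-(r₁ * (domSys (F.P K) M j).dj Y))) →
      (∀ (j : Fin (k + 1)) (Y : (domSys (F.P K) M j).Dom), AnalyticOnNhd ℂ (old j Y) (sp j Y)) →
      ∀ (Z : (domSys (F.P K) M (k + 1)).Dom), ∀ τ ∈ terms L M Z, AnalyticOnNhd ℂ (fun φ => T k Z τ t old φ) (sp (k + 1) Z))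
    (hT226 : ∀ k : ℕ, ∀ t ∈ D, ∀ old : OlderTerms (F.P K) 𝔸 M k,
      (∀ (j : Fin (k + 1)) (Y : (domSys (F.P K) M j).Dom), ∀ ψ ∈ sp j Y,
          ‖old j Y ψ‖ ≤ E₀ * Real.exp (-(r₁ * (domSys (F.P K) M j).dj Y))) →
      (∀ (j : Fin (k + 1)) (Y : (domSys (F.P K) M j).Dom), AnalyticOnNhd ℂ (old j Y) (sp j Y)) →
      ∀ (Z : (domSys (F.P K) M (k + 1)).Dom) (φ : CPair (F.P K) 𝔸), φ ∈ sp (k + 1) Z → ∀ τ ∈ terms L M Z,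
        ‖T k Z τ t old φ‖ ≤ weight L M c Z a τ * Real.exp (a₅ * ((Z.1).card : ℝ))) :
    ∀ k : ℕ, ∀ t ∈ D, ∀ old : OlderTerms (F.P K) 𝔸 M k,
      (∀ (j : Fin (k + 1)) (Y : (domSys (F.P K) M j).Dom), ∀ ψ ∈ sp j Y,
          ‖old j Y ψ‖ ≤ E₀ * Real.exp (-(r₁ * (domSys (F.P K) M j).dj Y))) →
      (∀ (j : Fin (k + 1)) (Y : (domSys (F.P K) M j).Dom), AnalyticOnNhd ℂ (old j Y) (sp j Y)) →
      (∀ (Z : (domSys (F.P K) M (k + 1)).Dom), ∀ i ∈ (GenTower.ofTerms L T k).idx Z,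
          AnalyticOnNhd ℂ (fun φ => (GenTower.ofTerms L T k).T i t old φ) (sp (k + 1) Z)) ∧
      (∀ (Z : (domSys (F.P K) M (k + 1)).Dom) (φ : CPair (F.P K) 𝔸), φ ∈ sp (k + 1) Z →
          ‖(GenTower.ofTerms L T k).H t old φ Z‖ ≤ ∑ τ ∈ terms L M Z, ‖T k Z τ t old φ‖) ∧
      (∀ (Z : (domSys (F.P K) M (k + 1)).Dom) (φ : CPair (F.P K) 𝔸), φ ∈ sp (k + 1) Z → ∀ τ ∈ terms L M Z,
          ‖T k Z τ t old φ‖ ≤ weight L M c Z a τ * Real.exp (a₅ * ((Z.1).card : ℝ))) := by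
  intro k t ht old hB hAn
  refine ⟨fun Z => ?_, fun Z φ _ => ?_, fun Z φ hφ τ hτ => hT226 k t ht old hB hAn Z φ hφ τ hτ⟩
  · -- (i): the indices at `Z` are the pairs `(Z, (𝐃,P))`, `(𝐃,P) ∈ terms L M Z` (W1's `forall_mem_idx_ofTerms_iff`), generic term = `T k Z (𝐃,P)` (`ofTerms_T`)
    rw [GenTower.ofTerms_apply]
    exact (forall_mem_idx_ofTerms_iff L (T k) Z).2 fun τ hτ => by simpa only [ofTerms_T] using hTan k t ht old hB hAn Z τ hτ
  · -- (ii): the domination clause is the triangle inequality over print's term sum (W1's `norm_H_ofTerms_le`)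
    rw [GenTower.ofTerms_apply]
    exact norm_H_ofTerms_le L (T k) t old φ Z

open Classical in
/-- **★ (T-an) + (T-226) ⟹ (GEN) AT THE TERM-INDEXED GENERATOR** (file 18's `stepGen_of_stepGenT` on §1): under ONE numerics bundle `Lemma3Numerics c M (½L) …` (`8 ≤ c.L = L`),
for every step, every `t ∈ D` and every admissible older-term table the activities of `GenTower.ofTerms L T` are analytic at the points of `sp (k+1) Z` and (2.38)-bounded
there with `A = C₃ε₁`, `R = (1−8δ)·½L·κ` — Lemma 3's resummation (file 12) over print's term sum. [cite: Balaban1988RG2Cluster, (2.14) p.15, (2.26) p.17 and Lemma 3 (2.38) p.20] -/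
theorem stepGen_ofTerms_of_termwise (T : GenTermFun (F.P K) 𝔸 M L) (D : Set ℂ)
    (sp : (j : ℕ) → (domSys (F.P K) M j).Dom → Set (CPair (F.P K) 𝔸)) {E₀ r₁ : ℝ} (c : B13.Consts) (hL : 8 ≤ c.L) (hLc : c.L = L)
    {a a₂ a₂' a₅ Aabs : ℝ} (hN : Lemma3Numerics c M ((c.L : ℝ) / 2) a a₂ a₂' a₅ Aabs)
    (hTan : ∀ k : ℕ, ∀ t ∈ D, ∀ old : OlderTerms (F.P K) 𝔸 M k,
      (∀ (j : Fin (k + 1)) (Y : (domSys (F.P K) M j).Dom), ∀ ψ ∈ sp j Y,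
          ‖old j Y ψ‖ ≤ E₀ * Real.exp (-(r₁ * (domSys (F.P K) M j).dj Y))) →
      (∀ (j : Fin (k + 1)) (Y : (domSys (F.P K) M j).Dom), AnalyticOnNhd ℂ (old j Y) (sp j Y)) →
      ∀ (Z : (domSys (F.P K) M (k + 1)).Dom), ∀ τ ∈ terms L M Z, AnalyticOnNhd ℂ (fun φ => T k Z τ t old φ) (sp (k + 1) Z))
    (hT226 : ∀ k : ℕ, ∀ t ∈ D, ∀ old : OlderTerms (F.P K) 𝔸 M k,
      (∀ (j : Fin (k + 1)) (Y : (domSys (F.P K) M j).Dom), ∀ ψ ∈ sp j Y,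
          ‖old j Y ψ‖ ≤ E₀ * Real.exp (-(r₁ * (domSys (F.P K) M j).dj Y))) →
      (∀ (j : Fin (k + 1)) (Y : (domSys (F.P K) M j).Dom), AnalyticOnNhd ℂ (old j Y) (sp j Y)) →
      ∀ (Z : (domSys (F.P K) M (k + 1)).Dom) (φ : CPair (F.P K) 𝔸), φ ∈ sp (k + 1) Z → ∀ τ ∈ terms L M Z,
        ‖T k Z τ t old φ‖ ≤ weight L M c Z a τ * Real.exp (a₅ * ((Z.1).card : ℝ))) :
    ∀ k : ℕ, ∀ t ∈ D, ∀ old : OlderTerms (F.P K) 𝔸 M k,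
      (∀ (j : Fin (k + 1)) (Y : (domSys (F.P K) M j).Dom), ∀ ψ ∈ sp j Y,
          ‖old j Y ψ‖ ≤ E₀ * Real.exp (-(r₁ * (domSys (F.P K) M j).dj Y))) →
      (∀ (j : Fin (k + 1)) (Y : (domSys (F.P K) M j).Dom), AnalyticOnNhd ℂ (old j Y) (sp j Y)) →
      (∀ Z : (domSys (F.P K) M (k + 1)).Dom, AnalyticOnNhd ℂ (fun φ => (GenTower.ofTerms L T k).H t old φ Z) (sp (k + 1) Z)) ∧
      (∀ (Z : (domSys (F.P K) M (k + 1)).Dom), ∀ φ ∈ sp (k + 1) Z,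
          ‖(GenTower.ofTerms L T k).H t old φ Z‖ ≤
            c.C3act * c.ε₁ * Real.exp (-((1 - 8 * c.δ) * ((c.L : ℝ) / 2) * c.κ * (domSys (F.P K) M (k + 1)).dj Z))) :=
  stepGen_of_stepGenT F K (GenTower.ofTerms L T) D sp c hL hLc hN (fun k t old Z τ φ => T k Z τ t old φ)
    (stepGenT_ofTerms_of_termwise F K L T D sp c hTan hT226)

end Collapse

/-! ## §2 Files 17 ∕ 18's conclusions at the term-indexed generator, from the two per-term schemas -/

section Consequences

variable (F : T4Family) (K : ℕ) {𝔸 : Type} [NormedRing 𝔸] [NormedAlgebra ℂ 𝔸] {M : ℕ} [NeZero M] (L : ℕ) [NeZero L]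

open Classical in
/-- **node00-def-W1's `RecAdmissible` FOR THE TERM-INDEXED GENERATOR FROM (T-an) + (T-226)** (file 17's `recAdmissible_of_stepGen` on §1): the generated older terms of
every step lie in the class «(1.18)`(E₀,r₁)` on the tables + analytic there», along every history with values in `D`. [cite: Balaban1987RG1, §1 p.263 and Thm 1 p.259; Balaban1988RG2Cluster, (2.14) p.15, (2.26) p.17, p.22] -/
theorem recAdmissible_ofTerms_of_termwise (T : GenTermFun (F.P K) 𝔸 M L) (D : Set ℂ)
    (sp : (j : ℕ) → (domSys (F.P K) M j).Dom → Set (CPair (F.P K) 𝔸)) {E₀ r₁ : ℝ} (hrestr : ∀ k, W1.SpRestr (sp (k + 1)))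
    (c : B13.Consts) (hL : 8 ≤ c.L) (hLc : c.L = L) {a a₂ a₂' a₅ Aabs : ℝ} (hN : Lemma3Numerics c M ((c.L : ℝ) / 2) a a₂ a₂' a₅ Aabs)
    (hTan : ∀ k : ℕ, ∀ t ∈ D, ∀ old : OlderTerms (F.P K) 𝔸 M k,
      (∀ (j : Fin (k + 1)) (Y : (domSys (F.P K) M j).Dom), ∀ ψ ∈ sp j Y,
          ‖old j Y ψ‖ ≤ E₀ * Real.exp (-(r₁ * (domSys (F.P K) M j).dj Y))) →
      (∀ (j : Fin (k + 1)) (Y : (domSys (F.P K) M j).Dom), AnalyticOnNhd ℂ (old j Y) (sp j Y)) →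
      ∀ (Z : (domSys (F.P K) M (k + 1)).Dom), ∀ τ ∈ terms L M Z, AnalyticOnNhd ℂ (fun φ => T k Z τ t old φ) (sp (k + 1) Z))
    (hT226 : ∀ k : ℕ, ∀ t ∈ D, ∀ old : OlderTerms (F.P K) 𝔸 M k,
      (∀ (j : Fin (k + 1)) (Y : (domSys (F.P K) M j).Dom), ∀ ψ ∈ sp j Y,
          ‖old j Y ψ‖ ≤ E₀ * Real.exp (-(r₁ * (domSys (F.P K) M j).dj Y))) →
      (∀ (j : Fin (k + 1)) (Y : (domSys (F.P K) M j).Dom), AnalyticOnNhd ℂ (old j Y) (sp j Y)) →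
      ∀ (Z : (domSys (F.P K) M (k + 1)).Dom) (φ : CPair (F.P K) 𝔸), φ ∈ sp (k + 1) Z → ∀ τ ∈ terms L M Z,
        ‖T k Z τ t old φ‖ ≤ weight L M c Z a τ * Real.exp (a₅ * ((Z.1).card : ℝ)))
    (hr₁ : 0 ≤ r₁) (hA : 0 ≤ c.C3act * c.ε₁) (hrate : r₁ + 2 * (64 * Real.log 162) + 2 ≤ (1 - 8 * c.δ) * ((c.L : ℝ) / 2) * c.κ)
    (hsmall : c.C3act * c.ε₁ * Real.exp (5 * r₁ + 1) * K₀ 64 8 * 9 * 64 < 1)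
    (hrenew : Real.exp 1 * 9 * 64 * K₀ 64 8 ^ 2 * (c.C3act * c.ε₁) ≤ E₀) :
    RecAdmissible (GenTower.ofTerms L T) D fun k => {old : OlderTerms (F.P K) 𝔸 M k |
      (∀ (j : Fin (k + 1)) (Y : (domSys (F.P K) M j).Dom), ∀ ψ ∈ sp j Y,
          ‖old j Y ψ‖ ≤ E₀ * Real.exp (-(r₁ * (domSys (F.P K) M j).dj Y))) ∧
      (∀ (j : Fin (k + 1)) (Y : (domSys (F.P K) M j).Dom), AnalyticOnNhd ℂ (old j Y) (sp j Y))} :=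
  recAdmissible_of_stepGen F K (GenTower.ofTerms L T) D sp hrestr (stepGen_ofTerms_of_termwise F K L T D sp c hL hLc hN hTan hT226) hA hr₁ hrate
    hsmall hrenew

open Classical in
/-- **THE (2.38) PAIR AT EVERY STEP OF THE GENERATED TOWER `toClusterTower (GenTower.ofTerms L T)`** on the boxes `]0, γ]^{k+1}` (file 17's `hLayer_toClusterTower_of_stepGen`
on §1; `]0, γ]` read inside `D`) — the per-step hypotheses of files 9–13 and of dag-n18-d's junctions, produced from (T-an) + (T-226). [cite: Balaban1988RG2Cluster, (2.14) p.15, (2.26) p.17 and Lemma 3 (2.38) p.20; Balaban1987RG1, Thm 1 p.259] -/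
theorem hLayer_toClusterTower_ofTerms_of_termwise (T : GenTermFun (F.P K) 𝔸 M L) (D : Set ℂ)
    (sp : (j : ℕ) → (domSys (F.P K) M j).Dom → Set (CPair (F.P K) 𝔸)) {E₀ r₁ γ : ℝ} (hrestr : ∀ k, W1.SpRestr (sp (k + 1)))
    (c : B13.Consts) (hL : 8 ≤ c.L) (hLc : c.L = L) {a a₂ a₂' a₅ Aabs : ℝ} (hN : Lemma3Numerics c M ((c.L : ℝ) / 2) a a₂ a₂' a₅ Aabs)
    (hTan : ∀ k : ℕ, ∀ t ∈ D, ∀ old : OlderTerms (F.P K) 𝔸 M k,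
      (∀ (j : Fin (k + 1)) (Y : (domSys (F.P K) M j).Dom), ∀ ψ ∈ sp j Y,
          ‖old j Y ψ‖ ≤ E₀ * Real.exp (-(r₁ * (domSys (F.P K) M j).dj Y))) →
      (∀ (j : Fin (k + 1)) (Y : (domSys (F.P K) M j).Dom), AnalyticOnNhd ℂ (old j Y) (sp j Y)) →
      ∀ (Z : (domSys (F.P K) M (k + 1)).Dom), ∀ τ ∈ terms L M Z, AnalyticOnNhd ℂ (fun φ => T k Z τ t old φ) (sp (k + 1) Z))
    (hT226 : ∀ k : ℕ, ∀ t ∈ D, ∀ old : OlderTerms (F.P K) 𝔸 M k,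
      (∀ (j : Fin (k + 1)) (Y : (domSys (F.P K) M j).Dom), ∀ ψ ∈ sp j Y,
          ‖old j Y ψ‖ ≤ E₀ * Real.exp (-(r₁ * (domSys (F.P K) M j).dj Y))) →
      (∀ (j : Fin (k + 1)) (Y : (domSys (F.P K) M j).Dom), AnalyticOnNhd ℂ (old j Y) (sp j Y)) →
      ∀ (Z : (domSys (F.P K) M (k + 1)).Dom) (φ : CPair (F.P K) 𝔸), φ ∈ sp (k + 1) Z → ∀ τ ∈ terms L M Z,
        ‖T k Z τ t old φ‖ ≤ weight L M c Z a τ * Real.exp (a₅ * ((Z.1).card : ℝ)))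
    (hr₁ : 0 ≤ r₁) (hA : 0 ≤ c.C3act * c.ε₁) (hrate : r₁ + 2 * (64 * Real.log 162) + 2 ≤ (1 - 8 * c.δ) * ((c.L : ℝ) / 2) * c.κ)
    (hsmall : c.C3act * c.ε₁ * Real.exp (5 * r₁ + 1) * K₀ 64 8 * 9 * 64 < 1)
    (hrenew : Real.exp 1 * 9 * 64 * K₀ 64 8 ^ 2 * (c.C3act * c.ε₁) ≤ E₀) (hD : ∀ s ∈ Ioc (0 : ℝ) γ, ((s : ℝ) : ℂ) ∈ D) :
    ∀ k, (toClusterTower (GenTower.ofTerms L T) k).AnalyticH (box γ k) (sp (k + 1)) ∧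
      (toClusterTower (GenTower.ofTerms L T) k).Bound238 (box γ k) (sp (k + 1)) (c.C3act * c.ε₁) ((1 - 8 * c.δ) * ((c.L : ℝ) / 2) * c.κ) :=
  hLayer_toClusterTower_of_stepGen F K (GenTower.ofTerms L T) D sp hrestr (stepGen_ofTerms_of_termwise F K L T D sp c hL hLc hN hTan hT226) hA hr₁ hrate
    hsmall hrenew hD

open Classical in
/-- **(1.18) FOR THE GENERATED TOWER OF THE TERM-INDEXED GENERATOR** on every history set read inside `D` (file 17's `termBound118_toClusterTower_of_stepGen` on §1).
[cite: Balaban1987RG1, (1.18) p.263 and Thm 1 p.259; Balaban1988RG2Cluster, (2.26) p.17, (2.41) p.21 and p.22] -/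
theorem termBound118_toClusterTower_ofTerms_of_termwise (T : GenTermFun (F.P K) 𝔸 M L) (D : Set ℂ)
    (sp : (j : ℕ) → (domSys (F.P K) M j).Dom → Set (CPair (F.P K) 𝔸)) {E₀ r₁ : ℝ} (hrestr : ∀ k, W1.SpRestr (sp (k + 1)))
    (c : B13.Consts) (hL : 8 ≤ c.L) (hLc : c.L = L) {a a₂ a₂' a₅ Aabs : ℝ} (hN : Lemma3Numerics c M ((c.L : ℝ) / 2) a a₂ a₂' a₅ Aabs)
    (hTan : ∀ k : ℕ, ∀ t ∈ D, ∀ old : OlderTerms (F.P K) 𝔸 M k,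
      (∀ (j : Fin (k + 1)) (Y : (domSys (F.P K) M j).Dom), ∀ ψ ∈ sp j Y,
          ‖old j Y ψ‖ ≤ E₀ * Real.exp (-(r₁ * (domSys (F.P K) M j).dj Y))) →
      (∀ (j : Fin (k + 1)) (Y : (domSys (F.P K) M j).Dom), AnalyticOnNhd ℂ (old j Y) (sp j Y)) →
      ∀ (Z : (domSys (F.P K) M (k + 1)).Dom), ∀ τ ∈ terms L M Z, AnalyticOnNhd ℂ (fun φ => T k Z τ t old φ) (sp (k + 1) Z))
    (hT226 : ∀ k : ℕ, ∀ t ∈ D, ∀ old : OlderTerms (F.P K) 𝔸 M k,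
      (∀ (j : Fin (k + 1)) (Y : (domSys (F.P K) M j).Dom), ∀ ψ ∈ sp j Y,
          ‖old j Y ψ‖ ≤ E₀ * Real.exp (-(r₁ * (domSys (F.P K) M j).dj Y))) →
      (∀ (j : Fin (k + 1)) (Y : (domSys (F.P K) M j).Dom), AnalyticOnNhd ℂ (old j Y) (sp j Y)) →
      ∀ (Z : (domSys (F.P K) M (k + 1)).Dom) (φ : CPair (F.P K) 𝔸), φ ∈ sp (k + 1) Z → ∀ τ ∈ terms L M Z,
        ‖T k Z τ t old φ‖ ≤ weight L M c Z a τ * Real.exp (a₅ * ((Z.1).card : ℝ)))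
    (hr₁ : 0 ≤ r₁) (hA : 0 ≤ c.C3act * c.ε₁) (hrate : r₁ + 2 * (64 * Real.log 162) + 2 ≤ (1 - 8 * c.δ) * ((c.L : ℝ) / 2) * c.κ)
    (hsmall : c.C3act * c.ε₁ * Real.exp (5 * r₁ + 1) * K₀ 64 8 * 9 * 64 < 1)
    (hrenew : Real.exp 1 * 9 * 64 * K₀ 64 8 ^ 2 * (c.C3act * c.ε₁) ≤ E₀) (W : Set (ℕ → ℝ)) (hW : ∀ g ∈ W, ∀ n, ((g n : ℝ) : ℂ) ∈ D) :
    TermBound118 (toClusterTower (GenTower.ofTerms L T)) W sp E₀ r₁ :=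
  termBound118_toClusterTower_of_stepGen F K (GenTower.ofTerms L T) D sp hrestr (stepGen_ofTerms_of_termwise F K L T D sp c hL hLc hN hTan hT226) hA
    hr₁ hrate hsmall hrenew W hW

end Consequences

/-! ## §2b L05 ∕ L06 at the admissible pairing of record for term-indexed generators -/

section Admissible

variable (F : T4Family) (M N k : ℕ) [NeZero M] (L : ℕ) [NeZero L] (sp : (k j : ℕ) → (domSys (F.P k) M j).Dom → Set (CPair (F.P k) (MatA N)))
  (gauge : GaugeField (F.P k) 0 (Node00.SU N) → GaugeField (F.P k) 0 (Node00.SU N) → ℝ) (hg : ∀ U U', 0 ≤ gauge U U')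
  (T₀ : GaugeField (F.P (k + 1)) 0 (Node00.SU N) → GaugeField (F.P k) 0 (Node00.SU N))
  (hT₀ : ∀ U : GaugeField (F.P (k + 1)) 0 (Node00.SU N),
    (∀ (j : ℕ) (Y : (domSys (F.P (k + 1)) M j).Dom), ofBackgroundC (ιSU N) U ∈ sp (k + 1) j Y) →
      ∀ (j : ℕ) (Y : (domSys (F.P k) M j).Dom), ofBackgroundC (ιSU N) (T₀ U) ∈ sp k j Y)

open Classical in
/-- **★ L05 OF THE END AT THE ADMISSIBLE PAIRING OF RECORD FOR `toClusterTower (GenTower.ofTerms L T)`, FROM (T-an) + (T-226) + ONE NUMERICS BUNDLE** (file 17 §3 on §1):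
`DecayBound ((LevelPairing.ofRecordAdm …).EA (toClusterTower (GenTower.ofTerms L T))) (Window γ) E₀ r₁`. [cite: Balaban1987RG1, (0.25) p.257, (1.18) p.263 and Thm 1 p.259; Balaban1988RG2Cluster, (2.14) p.15, (2.26) p.17, p.22] -/
theorem decayBound_EA_ofRecordAdm_ofTerms_of_termwise (T : GenTermFun (F.P k) (MatA N) M L) (D : Set ℂ) {E₀ r₁ γ : ℝ}
    (hrestr : ∀ m, W1.SpRestr (sp k (m + 1)))
    (c : B13.Consts) (hL : 8 ≤ c.L) (hLc : c.L = L) {a a₂ a₂' a₅ Aabs : ℝ} (hN : Lemma3Numerics c M ((c.L : ℝ) / 2) a a₂ a₂' a₅ Aabs)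
    (hTan : ∀ m : ℕ, ∀ t ∈ D, ∀ old : OlderTerms (F.P k) (MatA N) M m,
      (∀ (j : Fin (m + 1)) (Y : (domSys (F.P k) M j).Dom), ∀ ψ ∈ sp k j Y,
          ‖old j Y ψ‖ ≤ E₀ * Real.exp (-(r₁ * (domSys (F.P k) M j).dj Y))) →
      (∀ (j : Fin (m + 1)) (Y : (domSys (F.P k) M j).Dom), AnalyticOnNhd ℂ (old j Y) (sp k j Y)) →
      ∀ (Z : (domSys (F.P k) M (m + 1)).Dom), ∀ τ ∈ terms L M Z, AnalyticOnNhd ℂ (fun φ => T m Z τ t old φ) (sp k (m + 1) Z))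
    (hT226 : ∀ m : ℕ, ∀ t ∈ D, ∀ old : OlderTerms (F.P k) (MatA N) M m,
      (∀ (j : Fin (m + 1)) (Y : (domSys (F.P k) M j).Dom), ∀ ψ ∈ sp k j Y,
          ‖old j Y ψ‖ ≤ E₀ * Real.exp (-(r₁ * (domSys (F.P k) M j).dj Y))) →
      (∀ (j : Fin (m + 1)) (Y : (domSys (F.P k) M j).Dom), AnalyticOnNhd ℂ (old j Y) (sp k j Y)) →
      ∀ (Z : (domSys (F.P k) M (m + 1)).Dom) (φ : CPair (F.P k) (MatA N)), φ ∈ sp k (m + 1) Z → ∀ τ ∈ terms L M Z,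
        ‖T m Z τ t old φ‖ ≤ weight L M c Z a τ * Real.exp (a₅ * ((Z.1).card : ℝ)))
    (hr₁ : 0 ≤ r₁) (hA : 0 ≤ c.C3act * c.ε₁) (hrate : r₁ + 2 * (64 * Real.log 162) + 2 ≤ (1 - 8 * c.δ) * ((c.L : ℝ) / 2) * c.κ)
    (hsmall : c.C3act * c.ε₁ * Real.exp (5 * r₁ + 1) * K₀ 64 8 * 9 * 64 < 1)
    (hrenew : Real.exp 1 * 9 * 64 * K₀ 64 8 ^ 2 * (c.C3act * c.ε₁) ≤ E₀) (hD : ∀ s ∈ Ioc (0 : ℝ) γ, ((s : ℝ) : ℂ) ∈ D) :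
    DecayBound ((LevelPairing.ofRecordAdm F M N k sp gauge hg T₀ hT₀).EA (toClusterTower (GenTower.ofTerms L T))) (Window γ) E₀ r₁ :=
  decayBound_EA_ofRecordAdm_toClusterTower_of_stepGen F M N k sp gauge hg T₀ hT₀ (GenTower.ofTerms L T) D hrestr
    (stepGen_ofTerms_of_termwise F k L T D (sp k) c hL hLc hN hTan hT226) hA hr₁ hrate hsmall hrenew hD

open Classical in
/-- **★ L06 OF THE END AT THE ADMISSIBLE PAIRING OF RECORD FOR A RUN-B TOWER `toClusterTower (GenTower.ofTerms L T′)` on `F.P (k+1)`, FROM (T-an) + (T-226)** (file 17 §3 on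
§1; the pairing of record preserves `d_j`, the history `b∷g` stays in the window): for every `b ∈ ]0, γ]`, `DecayBound ((LevelPairing.ofRecordAdm …).EB (toClusterTower
(GenTower.ofTerms L T′)) b) (Window γ) E₀ r₁`. [cite: Balaban1987RG1, (0.24)-(0.25) p.257, (1.18) p.263 and Thm 1 p.259; Balaban1988RG2Cluster, (2.14) p.15, (2.26) p.17, p.22] -/
theorem decayBound_EB_ofRecordAdm_ofTerms_of_termwise (T' : GenTermFun (F.P (k + 1)) (MatA N) M L) (D : Set ℂ) {E₀ r₁ γ : ℝ}
    (hrestr : ∀ m, W1.SpRestr (sp (k + 1) (m + 1)))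
    (c : B13.Consts) (hL : 8 ≤ c.L) (hLc : c.L = L) {a a₂ a₂' a₅ Aabs : ℝ} (hN : Lemma3Numerics c M ((c.L : ℝ) / 2) a a₂ a₂' a₅ Aabs)
    (hTan : ∀ m : ℕ, ∀ t ∈ D, ∀ old : OlderTerms (F.P (k + 1)) (MatA N) M m,
      (∀ (j : Fin (m + 1)) (Y : (domSys (F.P (k + 1)) M j).Dom), ∀ ψ ∈ sp (k + 1) j Y,
          ‖old j Y ψ‖ ≤ E₀ * Real.exp (-(r₁ * (domSys (F.P (k + 1)) M j).dj Y))) →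
      (∀ (j : Fin (m + 1)) (Y : (domSys (F.P (k + 1)) M j).Dom), AnalyticOnNhd ℂ (old j Y) (sp (k + 1) j Y)) →
      ∀ (Z : (domSys (F.P (k + 1)) M (m + 1)).Dom), ∀ τ ∈ terms L M Z, AnalyticOnNhd ℂ (fun φ => T' m Z τ t old φ) (sp (k + 1) (m + 1) Z))
    (hT226 : ∀ m : ℕ, ∀ t ∈ D, ∀ old : OlderTerms (F.P (k + 1)) (MatA N) M m,
      (∀ (j : Fin (m + 1)) (Y : (domSys (F.P (k + 1)) M j).Dom), ∀ ψ ∈ sp (k + 1) j Y,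
          ‖old j Y ψ‖ ≤ E₀ * Real.exp (-(r₁ * (domSys (F.P (k + 1)) M j).dj Y))) →
      (∀ (j : Fin (m + 1)) (Y : (domSys (F.P (k + 1)) M j).Dom), AnalyticOnNhd ℂ (old j Y) (sp (k + 1) j Y)) →
      ∀ (Z : (domSys (F.P (k + 1)) M (m + 1)).Dom) (φ : CPair (F.P (k + 1)) (MatA N)), φ ∈ sp (k + 1) (m + 1) Z → ∀ τ ∈ terms L M Z,
        ‖T' m Z τ t old φ‖ ≤ weight L M c Z a τ * Real.exp (a₅ * ((Z.1).card : ℝ)))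
    (hr₁ : 0 ≤ r₁) (hA : 0 ≤ c.C3act * c.ε₁) (hrate : r₁ + 2 * (64 * Real.log 162) + 2 ≤ (1 - 8 * c.δ) * ((c.L : ℝ) / 2) * c.κ)
    (hsmall : c.C3act * c.ε₁ * Real.exp (5 * r₁ + 1) * K₀ 64 8 * 9 * 64 < 1)
    (hrenew : Real.exp 1 * 9 * 64 * K₀ 64 8 ^ 2 * (c.C3act * c.ε₁) ≤ E₀) (hD : ∀ s ∈ Ioc (0 : ℝ) γ, ((s : ℝ) : ℂ) ∈ D) {b : ℝ}
    (hb : b ∈ Ioc (0 : ℝ) γ) :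
    DecayBound ((LevelPairing.ofRecordAdm F M N k sp gauge hg T₀ hT₀).EB (toClusterTower (GenTower.ofTerms L T')) b) (Window γ) E₀ r₁ :=
  decayBound_EB_ofRecordAdm_toClusterTower_of_stepGen F M N k sp gauge hg T₀ hT₀ (GenTower.ofTerms L T') D hrestr
    (stepGen_ofTerms_of_termwise F (k + 1) L T' D (sp (k + 1)) c hL hLc hN hTan hT226) hA hr₁ hrate hsmall hrenew hD hb

end Admissible

/-! ## §3 At the tree's witness numerals: the two per-term schemas + the restriction property ONLY -/

section Witness

variable (F : T4Family) (K : ℕ) {𝔸 : Type} [NormedRing 𝔸] [NormedAlgebra ℂ 𝔸] {M : ℕ} [NeZero M]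

open Classical in
/-- **★★ W1's `RecAdmissible` FOR THE TERM-INDEXED GENERATOR AT THE WITNESS NUMERALS** (file 19 §2: `consts`, block factor `8`, rate `aw + 40M`, `a₅ = ½`, (1.18)-letters
`(consts.E₀, consts.κ)`): hypotheses = (T-an) + (T-226 at the witness weights) + the tables' restriction property — every numeric clause discharged; for term-functional
families of ANY bond-cube side `M`. [cite: Balaban1987RG1, §1 p.263 and Thm 1 p.259; Balaban1988RG2Cluster, (2.14) p.15, (2.26) p.17, p.21 (closing paragraph), p.22] -/
theorem recAdmissible_ofTerms_of_termwise_consts (T : GenTermFun (F.P K) 𝔸 M 8) (D : Set ℂ)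
    (sp : (j : ℕ) → (domSys (F.P K) M j).Dom → Set (CPair (F.P K) 𝔸)) (hrestr : ∀ k, W1.SpRestr (sp (k + 1)))
    (hTan : ∀ k : ℕ, ∀ t ∈ D, ∀ old : OlderTerms (F.P K) 𝔸 M k,
      (∀ (j : Fin (k + 1)) (Y : (domSys (F.P K) M j).Dom), ∀ ψ ∈ sp j Y,
          ‖old j Y ψ‖ ≤ consts.E₀ * Real.exp (-(consts.κ * (domSys (F.P K) M j).dj Y))) →
      (∀ (j : Fin (k + 1)) (Y : (domSys (F.P K) M j).Dom), AnalyticOnNhd ℂ (old j Y) (sp j Y)) →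
      ∀ (Z : (domSys (F.P K) M (k + 1)).Dom), ∀ τ ∈ terms 8 M Z, AnalyticOnNhd ℂ (fun φ => T k Z τ t old φ) (sp (k + 1) Z))
    (hT226 : ∀ k : ℕ, ∀ t ∈ D, ∀ old : OlderTerms (F.P K) 𝔸 M k,
      (∀ (j : Fin (k + 1)) (Y : (domSys (F.P K) M j).Dom), ∀ ψ ∈ sp j Y,
          ‖old j Y ψ‖ ≤ consts.E₀ * Real.exp (-(consts.κ * (domSys (F.P K) M j).dj Y))) →
      (∀ (j : Fin (k + 1)) (Y : (domSys (F.P K) M j).Dom), AnalyticOnNhd ℂ (old j Y) (sp j Y)) →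
      ∀ (Z : (domSys (F.P K) M (k + 1)).Dom) (φ : CPair (F.P K) 𝔸), φ ∈ sp (k + 1) Z → ∀ τ ∈ terms 8 M Z,
        ‖T k Z τ t old φ‖ ≤ weight 8 M consts Z (aw + 40 * (M : ℝ)) τ * Real.exp (1 / 2 * ((Z.1).card : ℝ))) :
    RecAdmissible (GenTower.ofTerms 8 T) D fun k => {old : OlderTerms (F.P K) 𝔸 M k |
      (∀ (j : Fin (k + 1)) (Y : (domSys (F.P K) M j).Dom), ∀ ψ ∈ sp j Y,
          ‖old j Y ψ‖ ≤ consts.E₀ * Real.exp (-(consts.κ * (domSys (F.P K) M j).dj Y))) ∧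
      (∀ (j : Fin (k + 1)) (Y : (domSys (F.P K) M j).Dom), AnalyticOnNhd ℂ (old j Y) (sp j Y))} := by
  obtain ⟨hL, hL8, hN, hκ, hC3pos, hlarge, hsmall, hrenew, -⟩ := chainNumerals_consts_anyM M
  exact recAdmissible_ofTerms_of_termwise F K 8 T D sp hrestr consts hL hL8 hN hTan hT226 hκ hC3pos hlarge hsmall hrenew

open Classical in
/-- **★★ THE (2.38) PAIR AT EVERY STEP OF `toClusterTower (GenTower.ofTerms 8 T)` AT THE WITNESS NUMERALS**, boxes `]0, γ]^{k+1}` read inside `D`: hypotheses = (T-an) +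
(T-226 at the witness weights) + restriction property + `]0,γ] ⊆ D` ONLY. [cite: Balaban1988RG2Cluster, (2.14) p.15, (2.26) p.17, Lemma 3 (2.38) p.20, p.21 (closing paragraph); Balaban1987RG1, Thm 1 p.259] -/
theorem hLayer_toClusterTower_ofTerms_of_termwise_consts (T : GenTermFun (F.P K) 𝔸 M 8) (D : Set ℂ)
    (sp : (j : ℕ) → (domSys (F.P K) M j).Dom → Set (CPair (F.P K) 𝔸)) {γ : ℝ} (hrestr : ∀ k, W1.SpRestr (sp (k + 1)))
    (hTan : ∀ k : ℕ, ∀ t ∈ D, ∀ old : OlderTerms (F.P K) 𝔸 M k,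
      (∀ (j : Fin (k + 1)) (Y : (domSys (F.P K) M j).Dom), ∀ ψ ∈ sp j Y,
          ‖old j Y ψ‖ ≤ consts.E₀ * Real.exp (-(consts.κ * (domSys (F.P K) M j).dj Y))) →
      (∀ (j : Fin (k + 1)) (Y : (domSys (F.P K) M j).Dom), AnalyticOnNhd ℂ (old j Y) (sp j Y)) →
      ∀ (Z : (domSys (F.P K) M (k + 1)).Dom), ∀ τ ∈ terms 8 M Z, AnalyticOnNhd ℂ (fun φ => T k Z τ t old φ) (sp (k + 1) Z))
    (hT226 : ∀ k : ℕ, ∀ t ∈ D, ∀ old : OlderTerms (F.P K) 𝔸 M k,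
      (∀ (j : Fin (k + 1)) (Y : (domSys (F.P K) M j).Dom), ∀ ψ ∈ sp j Y,
          ‖old j Y ψ‖ ≤ consts.E₀ * Real.exp (-(consts.κ * (domSys (F.P K) M j).dj Y))) →
      (∀ (j : Fin (k + 1)) (Y : (domSys (F.P K) M j).Dom), AnalyticOnNhd ℂ (old j Y) (sp j Y)) →
      ∀ (Z : (domSys (F.P K) M (k + 1)).Dom) (φ : CPair (F.P K) 𝔸), φ ∈ sp (k + 1) Z → ∀ τ ∈ terms 8 M Z,
        ‖T k Z τ t old φ‖ ≤ weight 8 M consts Z (aw + 40 * (M : ℝ)) τ * Real.exp (1 / 2 * ((Z.1).card : ℝ)))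
    (hD : ∀ s ∈ Ioc (0 : ℝ) γ, ((s : ℝ) : ℂ) ∈ D) :
    ∀ k, (toClusterTower (GenTower.ofTerms 8 T) k).AnalyticH (box γ k) (sp (k + 1)) ∧
      (toClusterTower (GenTower.ofTerms 8 T) k).Bound238 (box γ k) (sp (k + 1)) (consts.C3act * consts.ε₁)
        ((1 - 8 * consts.δ) * ((consts.L : ℝ) / 2) * consts.κ) := by
  obtain ⟨hL, hL8, hN, hκ, hC3pos, hlarge, hsmall, hrenew, -⟩ := chainNumerals_consts_anyM M
  exact hLayer_toClusterTower_ofTerms_of_termwise F K 8 T D sp hrestr consts hL hL8 hN hTan hT226 hκ hC3pos hlarge hsmall hrenew hD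

end Witness

/-! ## §4 Honesty: the zero term functional -/

section Honesty

variable (F : T4Family) (K : ℕ) {𝔸 : Type} [NormedRing 𝔸] [NormedAlgebra ℂ 𝔸] {M : ℕ} [NeZero M] (L : ℕ) [NeZero L]

/-- **AT THE ZERO TERM FUNCTIONAL BOTH PER-TERM SCHEMAS HOLD OUTRIGHT** (every term is the zero function: analytic everywhere, and `‖0‖ = 0 ≤ weight·e^{a₅|Z|}` for
non-negative weights — `hw`, supplied by `B13Lemma3TorusTerms.weight_nonneg` under `0 ≤ α₆·ε₂`) — W1's `recTerm_ofTerms_zero` species: the junction pins the index set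
and the shape of the dependence, nothing analytic; a producer must name the term functional OF RECORD. [cite: Balaban1988RG2Cluster, (2.14) p.15 (bookkeeping; honesty about the typed junction)] -/
theorem termwise_ofTerms_zero (D : Set ℂ) (sp : (j : ℕ) → (domSys (F.P K) M j).Dom → Set (CPair (F.P K) 𝔸)) {E₀ r₁ : ℝ} (c : B13.Consts) {a a₅ : ℝ}
    (hw : ∀ (k : ℕ) (Z : (domSys (F.P K) M (k + 1)).Dom), ∀ τ ∈ terms L M Z, 0 ≤ weight L M c Z a τ) :
    (∀ k : ℕ, ∀ t ∈ D, ∀ old : OlderTerms (F.P K) 𝔸 M k,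
      (∀ (j : Fin (k + 1)) (Y : (domSys (F.P K) M j).Dom), ∀ ψ ∈ sp j Y,
          ‖old j Y ψ‖ ≤ E₀ * Real.exp (-(r₁ * (domSys (F.P K) M j).dj Y))) →
      (∀ (j : Fin (k + 1)) (Y : (domSys (F.P K) M j).Dom), AnalyticOnNhd ℂ (old j Y) (sp j Y)) →
      ∀ (Z : (domSys (F.P K) M (k + 1)).Dom), ∀ τ ∈ terms L M Z,
        AnalyticOnNhd ℂ (fun φ => (0 : GenTermFun (F.P K) 𝔸 M L) k Z τ t old φ) (sp (k + 1) Z)) ∧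
    (∀ k : ℕ, ∀ t ∈ D, ∀ old : OlderTerms (F.P K) 𝔸 M k,
      (∀ (j : Fin (k + 1)) (Y : (domSys (F.P K) M j).Dom), ∀ ψ ∈ sp j Y,
          ‖old j Y ψ‖ ≤ E₀ * Real.exp (-(r₁ * (domSys (F.P K) M j).dj Y))) →
      (∀ (j : Fin (k + 1)) (Y : (domSys (F.P K) M j).Dom), AnalyticOnNhd ℂ (old j Y) (sp j Y)) →
      ∀ (Z : (domSys (F.P K) M (k + 1)).Dom) (φ : CPair (F.P K) 𝔸), φ ∈ sp (k + 1) Z → ∀ τ ∈ terms L M Z,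
        ‖(0 : GenTermFun (F.P K) 𝔸 M L) k Z τ t old φ‖ ≤ weight L M c Z a τ * Real.exp (a₅ * ((Z.1).card : ℝ))) := by
  refine ⟨fun k t _ old _ _ Z τ _ => ?_, fun k t _ old _ _ Z φ _ τ hτ => ?_⟩
  · exact analyticOnNhd_const
  · simp only [Pi.zero_apply, norm_zero]
    exact mul_nonneg (hw k Z τ hτ) (Real.exp_nonneg _)

end Honesty

end Summit.QuantumFields.YangMills.BalabanUVNodes.N18HLayerW1TermIndexed

end
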